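import Summits.AtomisticToContinuum.HydrodynamicLimit.Theorems.JParityClosureEvenStressEnskogEnskogIdentificationIntegrable
import Literature.MathematicalPhysics.KineticTheory.MicroscaleWindowFunctionals
import HarnessLib

/-!
# Velocity equilibration at rung 0 (stub S3b3 `stub_velocityEquilibrationRung0_of_deviation` of the
# line `preshock-kinetic-slaving`, crux `JParityClosure.EvenStressEnskog`, stmt-AtomisticToContinuum-13079)
# — helper file 1: the pathwise `∫⁻` bound of `|oneBodyStat − oneBodyPred|` along a good orbit

For the one-body functionals of `MicroscaleWindowFunctionals.lean`,
`oneBodyStat = ∫₀^τ ∫ St(s, Φ_s z, x) dx ds`, `oneBodyPred = ∫₀^τ ∫ Pr(s, Φ_s z, x) dx ds` with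

* `St(s, w, x) = χ(s,x) k(σ³ρ_r(w,x)) S(w,x)`, `S(w,x) = ∫ b_r(y,x) F(v, u_r(w,x), θ_r(w,x)) dμ_w(y,v)`,
* `Pr(s, w, x) = χ(s,x) k(σ³ρ_r(w,x)) ρ_r(w,x) H(w,x)`, `H(w,x) = ∫ F(v, u_r, θ_r) M_{1,θ_r,u_r}(v) dv`,

a continuous `χ` with `|χ| ≤ C_χ` on `[0, τ] × 𝕋³`, a continuous weight `k` with `|k| ≤ C_k` on `[0, ∞)`
(`σ ≥ 0`, `r > 0`) and ANY continuous test function `F`, we prove for every GOOD initial datum `z`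

  `ofReal |oneBodyStat − oneBodyPred| ≤ ofReal (C_χ C_k) · ∫⁻_{s ∈ [0,τ]} ∫⁻_x ofReal |D(Φ_s z, x)|`,
  `D(w, x) = S(w, x) − ρ_r(w, x) H(w, x)`

(`ofReal_abs_oneBodyStat_sub_oneBodyPred_le`).  No integrability or energy bound is needed: the
model-free inequality `ofReal |∫ f − ∫ g| ≤ ∫⁻ ofReal |f − g|` (`ofReal_abs_integral_sub_le_lintegral`)
holds as soon as `f − g` is a.e.-strongly measurable (if `f − g` is not integrable the right-hand side
is `∞`; if it is, either both Bochner integrals are honest or both are junk `0`), and it is applied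
twice — in `x ∈ 𝕋³` at fixed time (joint Borel measurability of the two integrands,
`measurable_oneBodyStatIntegrand_prod`, `measurable_oneBodyPredIntegrand_prod`) and in `s ∈ [0, τ]`
along the orbit (Fubini measurability composed with the measurable good orbit,
`measurable_flow_of_mem_good`) — together with the pointwise algebra `St − Pr = (χ k) · D`.

References: H. Spohn, *Large Scale Dynamics of Interacting Particles* (1991), Part I §3.2
(empirical fields tested along the flow); C. Cercignani, R. Illner, M. Pulvirenti (1994) §4.2
(the good set of the hard-sphere flow).
-/

noncomputable section

open scoped BigOperators InnerProductSpace Topology ENNReal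
open MeasureTheory Filter Set
open Literature.MathematicalPhysics.KineticTheory Literature.Analysis.FluidPDE
open Literature.MathematicalPhysics.KineticTheory.StationaryMicroscale

namespace Summit.AtomisticToContinuum.HydrodynamicLimit.Theorems.EvenStressEnskog

variable {N : ℕ}

/-! ## A model-free `∫⁻` bound of a difference of Bochner integrals -/

/-- **`ofReal |∫ f − ∫ g| ≤ ∫⁻ ofReal |f − g|` with no integrability hypothesis**, for real functions
whose difference is a.e.-strongly measurable: if `f − g` is not integrable the right-hand side is `∞`;
if it is integrable then either both `f` and `g` are (and this is `|∫ (f − g)| ≤ ∫ |f − g|`) or neither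
is (and the left-hand side is `|0 − 0| = 0`). [folklore] -/
theorem ofReal_abs_integral_sub_le_lintegral {α : Type*} [MeasurableSpace α] {μ : Measure α}
    {f g : α → ℝ} (hm : AEStronglyMeasurable (fun x => f x - g x) μ) :
    ENNReal.ofReal |(∫ x, f x ∂μ) - ∫ x, g x ∂μ| ≤ ∫⁻ x, ENNReal.ofReal |f x - g x| ∂μ := by
  by_cases hfg : Integrable (fun x => f x - g x) μ
  · by_cases hf : Integrable f μ
    · have hg : Integrable g μ :=
        (hf.sub hfg).congr (ae_of_all _ fun x => by simp only [Pi.sub_apply, sub_sub_cancel])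
      rw [← integral_sub hf hg, ← Real.enorm_eq_ofReal_abs]
      exact (enorm_integral_le_lintegral_enorm _).trans_eq
        (lintegral_congr fun x => Real.enorm_eq_ofReal_abs _)
    · have hg : ¬Integrable g μ := fun hg =>
        hf ((hfg.add hg).congr (ae_of_all _ fun x => by simp only [Pi.add_apply, sub_add_cancel]))
      rw [integral_undef hf, integral_undef hg, sub_zero, abs_zero, ENNReal.ofReal_zero]
      exact bot_le
  · have hfi : ¬HasFiniteIntegral (fun x => f x - g x) μ := fun h => hfg ⟨hm, h⟩
    rw [hasFiniteIntegral_iff_norm, not_lt, top_le_iff] at hfi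
    simp only [Real.norm_eq_abs] at hfi
    rw [hfi]
    exact le_top

/-! ## Pointwise algebra of the two integrands -/

/-- **`St − Pr = (χ k) · D`, hence `|St − Pr| ≤ C_χ C_k |D|`** when `|χ(s, ·)| ≤ C_χ` and `|k| ≤ C_k`
on `[0, ∞)` (`σ ≥ 0`, `r > 0`, so that `σ³ρ_r ≥ 0`). [folklore] -/
theorem abs_statIntegrand_sub_predIntegrand_le {σ r : ℝ} (hσ : 0 ≤ σ) (hr : 0 < r)
    {χ : ℝ × T3 → ℝ} {k : ℝ → ℝ} {s Cχ Ck : ℝ} (hχb : ∀ x, |χ (s, x)| ≤ Cχ)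
    (hkb : ∀ a, 0 ≤ a → |k a| ≤ Ck) (F : V3 × V3 × ℝ → ℝ) (w : Config (N + 1) (Fin 3) T3) (x : T3) :
    |χ (s, x) * k (σ ^ 3 * mollDensity r w x) *
          (∫ p, coneKernel r p.1 x *
              F (p.2, KineticEntropyBalance.uC r w x, mollTemperature r w x) ∂(empiricalMeasure w)) -
        χ (s, x) * k (σ ^ 3 * mollDensity r w x) * mollDensity r w x *
          ∫ v, F (v, KineticEntropyBalance.uC r w x, mollTemperature r w x) *
            localMaxwellian 1 (mollTemperature r w x) (KineticEntropyBalance.uC r w x) v| ≤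
      Cχ * Ck *
        |(∫ p, coneKernel r p.1 x *
              F (p.2, KineticEntropyBalance.uC r w x, mollTemperature r w x) ∂(empiricalMeasure w)) -
          mollDensity r w x *
            ∫ v, F (v, KineticEntropyBalance.uC r w x, mollTemperature r w x) *
              localMaxwellian 1 (mollTemperature r w x) (KineticEntropyBalance.uC r w x) v| := by
  have ha : 0 ≤ σ ^ 3 * mollDensity r w x :=
    mul_nonneg (pow_nonneg hσ 3) (mollDensity_nonneg_of_pos hr w x)
  have hCχ0 : 0 ≤ Cχ := (abs_nonneg _).trans (hχb x)
  set S := ∫ p, coneKernel r p.1 x *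
    F (p.2, KineticEntropyBalance.uC r w x, mollTemperature r w x) ∂(empiricalMeasure w)
  set H := ∫ v, F (v, KineticEntropyBalance.uC r w x, mollTemperature r w x) *
    localMaxwellian 1 (mollTemperature r w x) (KineticEntropyBalance.uC r w x) v
  have hid : χ (s, x) * k (σ ^ 3 * mollDensity r w x) * S -
      χ (s, x) * k (σ ^ 3 * mollDensity r w x) * mollDensity r w x * H =
      χ (s, x) * k (σ ^ 3 * mollDensity r w x) * (S - mollDensity r w x * H) := by ring
  rw [hid, abs_mul, abs_mul]
  exact mul_le_mul_of_nonneg_right (mul_le_mul (hχb x) (hkb _ ha) (abs_nonneg _) hCχ0) (abs_nonneg _)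

/-! ## Fixed time: the `x`-integrals over the torus -/

/-- **Fixed-time `∫⁻` bound**: for every configuration `w` and every time slice with `|χ(s, ·)| ≤ C_χ`,
`ofReal |∫ St(s, w, ·) − ∫ Pr(s, w, ·)| ≤ ofReal (C_χ C_k) ∫⁻_x ofReal |D(w, x)|` — the model-free
inequality `ofReal_abs_integral_sub_le_lintegral` (the difference of the two jointly Borel integrands is
measurable in `x`) and the pointwise bound `abs_statIntegrand_sub_predIntegrand_le`. [folklore] -/
theorem ofReal_abs_integral_stat_sub_pred_le {σ r : ℝ} (hσ : 0 ≤ σ) (hr : 0 < r)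
    {χ : ℝ × T3 → ℝ} (hχ : Continuous χ) {k : ℝ → ℝ} (hk : Continuous k)
    {F : V3 × V3 × ℝ → ℝ} (hF : Continuous F) {s Cχ Ck : ℝ} (hχb : ∀ x, |χ (s, x)| ≤ Cχ)
    (hkb : ∀ a, 0 ≤ a → |k a| ≤ Ck) (w : Config (N + 1) (Fin 3) T3) :
    ENNReal.ofReal
        |(∫ x : T3, χ (s, x) * k (σ ^ 3 * mollDensity r w x) *
            ∫ p, coneKernel r p.1 x *
                F (p.2, KineticEntropyBalance.uC r w x, mollTemperature r w x) ∂(empiricalMeasure w)) -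
          ∫ x : T3, χ (s, x) * k (σ ^ 3 * mollDensity r w x) * mollDensity r w x *
            ∫ v, F (v, KineticEntropyBalance.uC r w x, mollTemperature r w x) *
              localMaxwellian 1 (mollTemperature r w x) (KineticEntropyBalance.uC r w x) v| ≤
      ENNReal.ofReal (Cχ * Ck) * ∫⁻ x : T3, ENNReal.ofReal
        |(∫ p, coneKernel r p.1 x *
              F (p.2, KineticEntropyBalance.uC r w x, mollTemperature r w x) ∂(empiricalMeasure w)) -
          mollDensity r w x *
            ∫ v, F (v, KineticEntropyBalance.uC r w x, mollTemperature r w x) *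
              localMaxwellian 1 (mollTemperature r w x) (KineticEntropyBalance.uC r w x) v| := by
  have hCχ0 : 0 ≤ Cχ := (abs_nonneg _).trans (hχb 0)
  have hCk0 : 0 ≤ Ck := (abs_nonneg _).trans (hkb 0 le_rfl)
  have hSt : Measurable fun x : T3 => χ (s, x) * k (σ ^ 3 * mollDensity r w x) *
      ∫ p, coneKernel r p.1 x *
          F (p.2, KineticEntropyBalance.uC r w x, mollTemperature r w x) ∂(empiricalMeasure w) :=
    (measurable_oneBodyStatIntegrand_prod σ r hχ hk hF).comp
      (measurable_prodMk_left (x := ((s, w) : ℝ × Config (N + 1) (Fin 3) T3)))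
  have hPr : Measurable fun x : T3 => χ (s, x) * k (σ ^ 3 * mollDensity r w x) * mollDensity r w x *
      ∫ v, F (v, KineticEntropyBalance.uC r w x, mollTemperature r w x) *
        localMaxwellian 1 (mollTemperature r w x) (KineticEntropyBalance.uC r w x) v :=
    (measurable_oneBodyPredIntegrand_prod σ r hχ hk hF).comp
      (measurable_prodMk_left (x := ((s, w) : ℝ × Config (N + 1) (Fin 3) T3)))
  refine (ofReal_abs_integral_sub_le_lintegral (hSt.sub hPr).aestronglyMeasurable).trans ?_
  rw [← lintegral_const_mul' _ _ ENNReal.ofReal_ne_top]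
  refine lintegral_mono fun x => ?_
  rw [← ENNReal.ofReal_mul (mul_nonneg hCχ0 hCk0)]
  exact ENNReal.ofReal_le_ofReal (abs_statIntegrand_sub_predIntegrand_le hσ hr hχb hkb F w x)

/-! ## Along a good orbit: the registered sub-goal -/

/-- **Pathwise `∫⁻` bound of the one-body deviation along a good orbit** (sub-goal of
`stub_velocityEquilibrationRung0_of_deviation`, line `preshock-kinetic-slaving`): for `σ ≥ 0`, a
hard-sphere flow `Φ`, a good datum `z`, `r > 0`, continuous `χ, k, F` with `|χ| ≤ C_χ` on `[0, τ] × 𝕋³`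
and `|k| ≤ C_k` on `[0, ∞)`,
`ofReal |oneBodyStat − oneBodyPred| ≤ ofReal (C_χ C_k) ∫⁻_{s ∈ [0,τ]} ∫⁻_x ofReal |D(Φ_s z, x)|`,
`D = S − ρ_r H` the window deviation — the model-free inequality in time (the two `x`-integrals are
Borel in `s` along the measurable good orbit) on top of the fixed-time bound
`ofReal_abs_integral_stat_sub_pred_le`. [folklore] -/
theorem ofReal_abs_oneBodyStat_sub_oneBodyPred_le :
    ∀ {N : ℕ} {σ : ℝ}, 0 ≤ σ →
    ∀ (Φ : HardSphereFlow (Torus.geometry (Fin 3)) (hsDiameter σ N) (N + 1))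
      {z : Config (N + 1) (Fin 3) T3}, z ∈ Φ.good → ∀ {r : ℝ}, 0 < r → ∀ (τ : ℝ)
      {χ : ℝ × T3 → ℝ}, Continuous χ → ∀ {k : ℝ → ℝ}, Continuous k →
    ∀ {F : V3 × V3 × ℝ → ℝ}, Continuous F → ∀ {Cχ Ck : ℝ},
      (∀ s ∈ Set.Icc (0 : ℝ) τ, ∀ x, |χ (s, x)| ≤ Cχ) → (∀ a, 0 ≤ a → |k a| ≤ Ck) →
    ENNReal.ofReal |oneBodyStat σ N Φ τ χ k F r z - oneBodyPred σ N Φ τ χ k F r z| ≤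
      ENNReal.ofReal (Cχ * Ck) * ∫⁻ s in Set.Icc (0 : ℝ) τ, ∫⁻ x : T3, ENNReal.ofReal
        |(∫ q, coneKernel r q.1 x *
              F (q.2, KineticEntropyBalance.uC r (Φ.flow s z) x, mollTemperature r (Φ.flow s z) x)
            ∂(empiricalMeasure (Φ.flow s z))) -
          mollDensity r (Φ.flow s z) x *
            ∫ v, F (v, KineticEntropyBalance.uC r (Φ.flow s z) x, mollTemperature r (Φ.flow s z) x) *
              localMaxwellian 1 (mollTemperature r (Φ.flow s z) x)
                (KineticEntropyBalance.uC r (Φ.flow s z) x) v| := by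
  intro N σ hσ Φ z hz r hr τ χ hχ k hk F hF Cχ Ck hχb hkb
  have hA : Measurable fun s => ∫ x, χ (s, x) * k (σ ^ 3 * mollDensity r (Φ.flow s z) x) *
      ∫ p, coneKernel r p.1 x *
          F (p.2, KineticEntropyBalance.uC r (Φ.flow s z) x, mollTemperature r (Φ.flow s z) x)
        ∂(empiricalMeasure (Φ.flow s z)) :=
    ((measurable_oneBodyStatIntegrand_prod σ r hχ hk hF).stronglyMeasurable.integral_prod_right'
      (ν := volume)).measurable.comp (measurable_id.prodMk (measurable_flow_of_mem_good Φ hz))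
  have hB : Measurable fun s => ∫ x, χ (s, x) * k (σ ^ 3 * mollDensity r (Φ.flow s z) x) *
      mollDensity r (Φ.flow s z) x *
      ∫ v, F (v, KineticEntropyBalance.uC r (Φ.flow s z) x, mollTemperature r (Φ.flow s z) x) *
        localMaxwellian 1 (mollTemperature r (Φ.flow s z) x)
          (KineticEntropyBalance.uC r (Φ.flow s z) x) v :=
    ((measurable_oneBodyPredIntegrand_prod σ r hχ hk hF).stronglyMeasurable.integral_prod_right'
      (ν := volume)).measurable.comp (measurable_id.prodMk (measurable_flow_of_mem_good Φ hz))
  unfold oneBodyStat oneBodyPred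
  refine (ofReal_abs_integral_sub_le_lintegral (hA.sub hB).aestronglyMeasurable).trans ?_
  rw [← lintegral_const_mul' _ _ ENNReal.ofReal_ne_top]
  exact setLIntegral_mono' measurableSet_Icc fun s hs =>
    ofReal_abs_integral_stat_sub_pred_le hσ hr hχ hk hF (hχb s hs) hkb (Φ.flow s z)

end Summit.AtomisticToContinuum.HydrodynamicLimit.Theorems.EvenStressEnskog

end
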